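import Summits.QuantumFields.YangMills.Theorems.AlphaInputsT3ACv3AbelianTensor
import Summits.QuantumFields.YangMills.Theorems.AlphaInputsT3ACv3AbelianShapes1DSums
import Summits.QuantumFields.Balaban3D.Proofs.TorusLift
import HarnessLib

/-!
# `AlphaInputsT3ACv3AbelianTensorSums` — STRATEGY B for 2′, (LL) the linear regional lift: THE CORRECTORS ARE INVISIBLE TO THE TUBE AVERAGE, AND THE NAIVE LIFT IS EXACT —
# lane `pub-balaban3d`, seat alpha-2 (g5)

WHY.  Exactness of the lift `naive(A) + Σ_P (curl A)(P)·e_P + Σ_C φ_C·r_C` (sibling `…v3AbelianRegionalLift`): the `k`-fold linear (0.4) average is the tube sum up to a coboundary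
(`…v3AbelianLiftAvg`), the tube sum of the naive crossing-bond lift is `L^{3k}·A` exactly (one crossing bond per fine line of the tube), and the tube sum of EVERY corrector
component vanishes, because each carries a hosted cumulative `g^θ` in a slot transverse to the bond direction and `g^θ` has zero sum over every block (`…v3AbelianShapes1DSums`).
THIS FILE: §1 block labels in coordinates (`coarsen` through `val`); §2 offsets along a tube; §3 ★ the vanishing lemma (a transverse `g^θ`-factor kills the sum over the block's
offsets — split the offset at that coordinate) and `tubeSum (e01∕e02∕e12∕rC) = 0`; §4 the naive lift, ★ `tubeSum (naive A) = (L^k)³·A`, and its curl (`(curl A)(blockOf)` on the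
corner lines, zero elsewhere).
HONEST FRAMING.  Kernel algebra of explicit lattice functions; nothing of [B10]∕[7]∕[4] asserted; count-neutral helper toward R3 2′ (`stub_laneRecordsV3`, items 19935∕19936);
registry untouched; nothing about d = 4, the continuum, or a mass gap.

References: T. Bałaban, Commun. Math. Phys. 102 (1985) 277–309 [Balaban1985Variational] ((8) p.279); CMP 109 (1987) 249–301 [Balaban1987RG1] ((0.4), (0.11) p.253).
-/

set_option autoImplicit false

noncomputable section

namespace Summit.QuantumFields.YangMills.Theorems.AbelianEML.Tensor

open scoped BigOperators
open Literature.MathematicalPhysics.QuantumFieldTheory.Balaban1983to89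
open Literature.MathematicalPhysics.QuantumFieldTheory.Balaban1983to89.T3ContinuumYM3Torus
open Literature.MathematicalPhysics.QuantumFieldTheory.Balaban1983to89.BlockAveragingEMLProp2 (shiftN_apply)
open Literature.MathematicalPhysics.QuantumFieldTheory.Balaban1983to89.B10Eq47AxialChi (shiftN shiftN_zero shiftN_succ)
open Summit.QuantumFields.YangMills.Theorems.AbelianEML.Shapes1D
open Summit.QuantumFields.Balaban3D.Carriers (coarsen coarsen_succ)
open Summit.QuantumFields.Balaban3D.Proofs.TorusLift (val_coarsen)

variable {F : T3Family} {K k : ℕ}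

/-! ## §1 Block labels in coordinates -/

/-- Standing range from `k ≤ K`. [folklore] -/
theorem le_standing (hk : k ≤ K) : k ≤ (F.P K).m + (F.P K).K := le_trans hk (Nat.le_add_left _ _)

/-- **A finest site lies in the level-`k` block `y` iff its labels divided by `L^k` are the labels of `y`.** [cite: Balaban1987RG1, (0.3) p.252] -/
theorem coarsen_eq_iff (hk : k ≤ K) (z : Site (F.P K) 0) (y : Site (F.P K) k) : coarsen k z = y ↔ ∀ i, (z i).val / F.L ^ k = (y i).val := by
  constructor
  · rintro rfl i; exact (val_coarsen k (le_standing hk) z i).symm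
  · intro h; funext i; apply ZMod.val_injective; rw [val_coarsen k (le_standing hk)]; exact h i

/-! ## §2 Offsets along a tube -/

/-- Labels of the block sites (the generic `val_bsite`, read for the `T3Family` parameters). [folklore] -/
theorem val_bsite3 (hk : k ≤ K) (y : Site (F.P K) k) (r : Fin 3 → Fin (F.L ^ k)) (i : Fin 3) :
    ((bsite k y r) i).val = (y i).val * F.L ^ k + r i := val_bsite (le_standing hk) y r i

/-- The transverse offsets along the tube of `(y′, μ)` at offset `r`: `ρ_i = L^k·y′_i + r_i + (N₀ − L^k·y_i)` for `i ≠ μ`. [folklore] -/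
theorem rho_tube_ne (hk : k ≤ K) (y y' : Site (F.P K) k) (r : Fin 3 → Fin (F.L ^ k)) {μ i : Fin 3} (hi : i ≠ μ) (t : ℕ) :
    rho y (shiftN (bsite k y' r) μ t) i = F.L ^ k * (y' i).val + r i + (N0 F K - F.L ^ k * (y i).val) := by
  have hi' : ¬ (@Eq (Fin (F.P K).d) i μ) := fun h => hi h
  simp only [rho, shiftN_apply, hi', ↓reduceIte, add_zero, val_bsite3 hk]
  ring

/-- Along a tube every offset depends on the block offset only through its own coordinate. [folklore] -/
theorem rho_tube_congr (y y' : Site (F.P K) k) {r r' : Fin 3 → Fin (F.L ^ k)} (μ : Fin 3) (t : ℕ) {i : Fin 3} (h : r i = r' i) :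
    rho y (shiftN (bsite k y' r) μ t) i = rho y (shiftN (bsite k y' r') μ t) i := by
  simp only [rho, shiftN_apply, bsite, h]

/-! ## §3 Correctors are invisible to the tube average -/

/-- The tube sum of a `form3` one-form at `(y′, μ)` reads the `μ`-component along the tube. [cite: Balaban1987RG1, (0.4) p.253] -/
theorem tubeSum_form3 (e : Fin 3 → Site (F.P K) 0 → ℝ) (y' : Site (F.P K) k) (μ : Fin 3) :
    tubeSum k (form3 e) ⟨y', μ⟩ = ∑ r : Fin 3 → Fin (F.L ^ k), ∑ t : Fin (F.L ^ k), e μ (shiftN (bsite k y' r) μ t) := rfl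

/-- The hosted cumulative summed over one block's offsets along a transverse coordinate vanishes. [cite: Balaban1985Variational, (8) p.279] -/
theorem sum_offset_gS (hk : k ≤ K) (θ : Bool) (y y' : Site (F.P K) k) (i : Fin 3) :
    ∑ x : Fin (F.L ^ k), gS θ (F.L ^ k) (N0 F K) (F.L ^ k * (y' i).val + x + (N0 F K - F.L ^ k * (y i).val)) = 0 := by
  obtain ⟨h1, h2, h3⟩ := sizes (F := F) hk
  rw [Fin.sum_univ_eq_sum_range (fun x => gS θ (F.L ^ k) (N0 F K) (F.L ^ k * (y' i).val + x + (N0 F K - F.L ^ k * (y i).val)))]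
  exact sum_block_gS_shift h1 h2 h3 θ _ _ (ZMod.val_lt (y i)).le

/-- `0 ≠ 1` in `Fin 3`, as a rewrite to `False`. [folklore] -/
private theorem f01 : ((0 : Fin 3) = 1) = False := by decide
/-- `0 ≠ 2` in `Fin 3`. [folklore] -/
private theorem f02 : ((0 : Fin 3) = 2) = False := by decide
/-- `1 ≠ 0` in `Fin 3`. [folklore] -/
private theorem f10 : ((1 : Fin 3) = 0) = False := by decide
/-- `1 ≠ 2` in `Fin 3`. [folklore] -/
private theorem f12 : ((1 : Fin 3) = 2) = False := by decide
/-- `2 ≠ 0` in `Fin 3`. [folklore] -/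
private theorem f20 : ((2 : Fin 3) = 0) = False := by decide
/-- `2 ≠ 1` in `Fin 3`. [folklore] -/
private theorem f21 : ((2 : Fin 3) = 1) = False := by decide

/-- **★ THE VANISHING LEMMA, hosted cumulative in slot `0`** (tube direction `μ ≠ 0`): split the block offset at coordinate `0`; the other two factors do not depend on it, and the
cumulative has zero sum over the block. [cite: Balaban1985Variational, (8) p.279] -/
theorem tube_vanish0 (hk : k ≤ K) {μ : Fin 3} (hμ : (0 : Fin 3) ≠ μ) (θ : Bool) (y y' : Site (F.P K) k) (t : ℕ) (f1 f2 : ℕ → ℝ) :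
    ∑ r : Fin 3 → Fin (F.L ^ k), gS θ (F.L ^ k) (N0 F K) (rho y (shiftN (bsite k y' r) μ t) 0) *
      f1 (rho y (shiftN (bsite k y' r) μ t) 1) * f2 (rho y (shiftN (bsite k y' r) μ t) 2) = 0 := by
  have hn : 0 < F.L ^ k := (sizes (F := F) hk).2.2
  let e := Equiv.funSplitAt (0 : Fin 3) (Fin (F.L ^ k))
  rw [← Equiv.sum_comp e.symm, Fintype.sum_prod_type, Finset.sum_comm]
  refine Finset.sum_eq_zero fun g _ => ?_
  have h0 : ∀ x : Fin (F.L ^ k), (e.symm (x, g)) 0 = x := fun x => by simp [e]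
  have hj : ∀ (x x' : Fin (F.L ^ k)) (j : Fin 3), j ≠ 0 → (e.symm (x, g)) j = (e.symm (x', g)) j := fun x x' j hj => by simp [e, hj]
  set x₀ : Fin (F.L ^ k) := ⟨0, hn⟩
  have h1 : ∀ x, rho y (shiftN (bsite k y' (e.symm (x, g))) μ t) 1 = rho y (shiftN (bsite k y' (e.symm (x₀, g))) μ t) 1 :=
    fun x => rho_tube_congr y y' μ t (hj x x₀ 1 (by decide))
  have h2 : ∀ x, rho y (shiftN (bsite k y' (e.symm (x, g))) μ t) 2 = rho y (shiftN (bsite k y' (e.symm (x₀, g))) μ t) 2 :=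
    fun x => rho_tube_congr y y' μ t (hj x x₀ 2 (by decide))
  have hρ : ∀ x : Fin (F.L ^ k), rho y (shiftN (bsite k y' (e.symm (x, g))) μ t) 0 = F.L ^ k * (y' (0 : Fin 3)).val + x + (N0 F K - F.L ^ k * (y (0 : Fin 3)).val) :=
    fun x => by rw [rho_tube_ne hk y y' _ hμ, h0]
  simp only [h1, h2, hρ]
  rw [Finset.sum_congr rfl fun x _ => mul_assoc _ _ _, ← Finset.sum_mul, sum_offset_gS hk θ y y' 0, zero_mul]

/-- **The vanishing lemma, hosted cumulative in slot `1`** (tube direction `μ ≠ 1`). [cite: Balaban1985Variational, (8) p.279] -/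
theorem tube_vanish1 (hk : k ≤ K) {μ : Fin 3} (hμ : (1 : Fin 3) ≠ μ) (θ : Bool) (y y' : Site (F.P K) k) (t : ℕ) (f0 f2 : ℕ → ℝ) :
    ∑ r : Fin 3 → Fin (F.L ^ k), f0 (rho y (shiftN (bsite k y' r) μ t) 0) *
      gS θ (F.L ^ k) (N0 F K) (rho y (shiftN (bsite k y' r) μ t) 1) * f2 (rho y (shiftN (bsite k y' r) μ t) 2) = 0 := by
  have hn : 0 < F.L ^ k := (sizes (F := F) hk).2.2
  let e := Equiv.funSplitAt (1 : Fin 3) (Fin (F.L ^ k))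
  rw [← Equiv.sum_comp e.symm, Fintype.sum_prod_type, Finset.sum_comm]
  refine Finset.sum_eq_zero fun g _ => ?_
  have h0 : ∀ x : Fin (F.L ^ k), (e.symm (x, g)) 1 = x := fun x => by simp [e]
  have hj : ∀ (x x' : Fin (F.L ^ k)) (j : Fin 3), j ≠ 1 → (e.symm (x, g)) j = (e.symm (x', g)) j := fun x x' j hj => by simp [e, hj]
  set x₀ : Fin (F.L ^ k) := ⟨0, hn⟩
  have h1 : ∀ x, rho y (shiftN (bsite k y' (e.symm (x, g))) μ t) 0 = rho y (shiftN (bsite k y' (e.symm (x₀, g))) μ t) 0 :=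
    fun x => rho_tube_congr y y' μ t (hj x x₀ 0 (by decide))
  have h2 : ∀ x, rho y (shiftN (bsite k y' (e.symm (x, g))) μ t) 2 = rho y (shiftN (bsite k y' (e.symm (x₀, g))) μ t) 2 :=
    fun x => rho_tube_congr y y' μ t (hj x x₀ 2 (by decide))
  have hρ : ∀ x : Fin (F.L ^ k), rho y (shiftN (bsite k y' (e.symm (x, g))) μ t) 1 = F.L ^ k * (y' (1 : Fin 3)).val + x + (N0 F K - F.L ^ k * (y (1 : Fin 3)).val) :=
    fun x => by rw [rho_tube_ne hk y y' _ hμ, h0]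
  simp only [h1, h2, hρ]
  rw [Finset.sum_congr rfl fun x _ => show _ = f0 _ * f2 _ * gS θ (F.L ^ k) (N0 F K) _ from by ring, ← Finset.mul_sum, sum_offset_gS hk θ y y' 1,
    mul_zero]

/-- **The vanishing lemma, hosted cumulative in slot `2`** (tube direction `μ ≠ 2`). [cite: Balaban1985Variational, (8) p.279] -/
theorem tube_vanish2 (hk : k ≤ K) {μ : Fin 3} (hμ : (2 : Fin 3) ≠ μ) (θ : Bool) (y y' : Site (F.P K) k) (t : ℕ) (f0 f1 : ℕ → ℝ) :
    ∑ r : Fin 3 → Fin (F.L ^ k), f0 (rho y (shiftN (bsite k y' r) μ t) 0) *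
      f1 (rho y (shiftN (bsite k y' r) μ t) 1) * gS θ (F.L ^ k) (N0 F K) (rho y (shiftN (bsite k y' r) μ t) 2) = 0 := by
  have hn : 0 < F.L ^ k := (sizes (F := F) hk).2.2
  let e := Equiv.funSplitAt (2 : Fin 3) (Fin (F.L ^ k))
  rw [← Equiv.sum_comp e.symm, Fintype.sum_prod_type, Finset.sum_comm]
  refine Finset.sum_eq_zero fun g _ => ?_
  have h0 : ∀ x : Fin (F.L ^ k), (e.symm (x, g)) 2 = x := fun x => by simp [e]
  have hj : ∀ (x x' : Fin (F.L ^ k)) (j : Fin 3), j ≠ 2 → (e.symm (x, g)) j = (e.symm (x', g)) j := fun x x' j hj => by simp [e, hj]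
  set x₀ : Fin (F.L ^ k) := ⟨0, hn⟩
  have h1 : ∀ x, rho y (shiftN (bsite k y' (e.symm (x, g))) μ t) 0 = rho y (shiftN (bsite k y' (e.symm (x₀, g))) μ t) 0 :=
    fun x => rho_tube_congr y y' μ t (hj x x₀ 0 (by decide))
  have h2 : ∀ x, rho y (shiftN (bsite k y' (e.symm (x, g))) μ t) 1 = rho y (shiftN (bsite k y' (e.symm (x₀, g))) μ t) 1 :=
    fun x => rho_tube_congr y y' μ t (hj x x₀ 1 (by decide))
  have hρ : ∀ x : Fin (F.L ^ k), rho y (shiftN (bsite k y' (e.symm (x, g))) μ t) 2 = F.L ^ k * (y' (2 : Fin 3)).val + x + (N0 F K - F.L ^ k * (y (2 : Fin 3)).val) :=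
    fun x => by rw [rho_tube_ne hk y y' _ hμ, h0]
  simp only [h1, h2, hρ]
  rw [← Finset.mul_sum, sum_offset_gS hk θ y y' 2, mul_zero]

/-- **★ THE PLAQUETTE CORRECTOR `e01` IS INVISIBLE TO THE TUBE AVERAGE.** [cite: Balaban1985Variational, (8) p.279] -/
theorem tubeSum_e01 (hk : k ≤ K) (y y' : Site (F.P K) k) (μ : Fin 3) : tubeSum k (e01 F K k y) ⟨y', μ⟩ = 0 := by
  rw [e01, tubeSum_form3, Finset.sum_comm]
  refine Finset.sum_eq_zero fun t _ => ?_
  fin_cases μ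
  · simp only [Fin.zero_eta, Fin.isValue, if_true]
    have h := tube_vanish1 hk (μ := 0) (by decide) false y y' t (fun ρ => -h_ F K k false ρ) (fun ρ => b_ F K k ρ)
    rw [← neg_eq_zero, ← Finset.sum_neg_distrib] at h ⊢
    refine (Eq.trans (Finset.sum_congr rfl fun r _ => ?_) h)
    ring
  · simp only [Fin.mk_one, Fin.isValue, f10, if_true, if_false]
    exact tube_vanish0 hk (μ := 1) (by decide) false y y' t (fun ρ => c_ F K k ρ) (fun ρ => b_ F K k ρ)
  · simp only [Fin.reduceFinMk, Fin.isValue, f20, f21, if_false, Finset.sum_const_zero]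

/-- **★ THE PLAQUETTE CORRECTOR `e02` IS INVISIBLE TO THE TUBE AVERAGE.** [cite: Balaban1985Variational, (8) p.279] -/
theorem tubeSum_e02 (hk : k ≤ K) (y y' : Site (F.P K) k) (μ : Fin 3) : tubeSum k (e02 F K k y) ⟨y', μ⟩ = 0 := by
  rw [e02, tubeSum_form3, Finset.sum_comm]
  refine Finset.sum_eq_zero fun t _ => ?_
  fin_cases μ
  · simp only [Fin.zero_eta, Fin.isValue, if_true]
    have h := tube_vanish2 hk (μ := 0) (by decide) false y y' t (fun ρ => -h_ F K k false ρ) (fun ρ => N_ F K k ρ)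
    rw [← neg_eq_zero, ← Finset.sum_neg_distrib] at h ⊢
    refine (Eq.trans (Finset.sum_congr rfl fun r _ => ?_) h)
    ring
  · simp only [Fin.mk_one, Fin.isValue, f10, f12, if_false, Finset.sum_const_zero]
  · simp only [Fin.reduceFinMk, Fin.isValue, f20, if_true, if_false]
    exact tube_vanish0 hk (μ := 2) (by decide) false y y' t (fun ρ => b_ F K k ρ) (fun ρ => c_ F K k ρ)

/-- **★ THE PLAQUETTE CORRECTOR `e12` IS INVISIBLE TO THE TUBE AVERAGE.** [cite: Balaban1985Variational, (8) p.279] -/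
theorem tubeSum_e12 (hk : k ≤ K) (y y' : Site (F.P K) k) (μ : Fin 3) : tubeSum k (e12 F K k y) ⟨y', μ⟩ = 0 := by
  rw [e12, tubeSum_form3, Finset.sum_comm]
  refine Finset.sum_eq_zero fun t _ => ?_
  fin_cases μ
  · simp only [Fin.zero_eta, Fin.isValue, f01, f02, if_false, Finset.sum_const_zero]
  · simp only [Fin.mk_one, Fin.isValue, if_true]
    have h := tube_vanish2 hk (μ := 1) (by decide) false y y' t (fun ρ => -N_ F K k ρ) (fun ρ => h_ F K k false ρ)
    rw [← neg_eq_zero, ← Finset.sum_neg_distrib] at h ⊢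
    refine (Eq.trans (Finset.sum_congr rfl fun r _ => ?_) h)
    ring
  · simp only [Fin.reduceFinMk, Fin.isValue, f21, if_true, if_false]
    exact tube_vanish1 hk (μ := 2) (by decide) false y y' t (fun ρ => N_ F K k ρ) (fun ρ => c_ F K k ρ)

/-- **★ THE CUBE CORRECTOR `rC` IS INVISIBLE TO THE TUBE AVERAGE.** [cite: Balaban1985Variational, (8) p.279] -/
theorem tubeSum_rC (hk : k ≤ K) (θ : Fin 3 → Bool) (y y' : Site (F.P K) k) (μ : Fin 3) : tubeSum k (rC F K k θ y) ⟨y', μ⟩ = 0 := by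
  rw [rC, tubeSum_form3, Finset.sum_comm]
  refine Finset.sum_eq_zero fun t _ => ?_
  fin_cases μ
  · simp only [Fin.zero_eta, Fin.isValue, if_true]
    have h := tube_vanish2 hk (μ := 0) (by decide) (θ 2) y y' t (fun ρ => -h_ F K k false ρ) (fun ρ => g_ F K k false ρ - g_ F K k (θ 1) ρ)
    rw [← neg_eq_zero, ← Finset.sum_neg_distrib] at h ⊢
    refine (Eq.trans (Finset.sum_congr rfl fun r _ => ?_) h)
    ring
  · simp only [Fin.mk_one, Fin.isValue, f10, if_true, if_false]
    exact tube_vanish2 hk (μ := 1) (by decide) (θ 2) y y' t (fun ρ => g_ F K k false ρ - g_ F K k (θ 0) ρ) (fun ρ => h_ F K k (θ 1) ρ)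
  · simp only [Fin.reduceFinMk, Fin.isValue, f20, f21, if_false]
    have h := tube_vanish1 hk (μ := 2) (by decide) (θ 1) y y' t (fun ρ => -(g_ F K k false ρ - g_ F K k (θ 0) ρ)) (fun ρ => c_ F K k ρ)
    rw [← neg_eq_zero, ← Finset.sum_neg_distrib] at h ⊢
    refine (Eq.trans (Finset.sum_congr rfl fun r _ => ?_) h)
    ring

/-! ## §4 The naive crossing-bond lift -/

section Naive

variable (F K k)

/-- **THE NAIVE LIFT** of a level-`k` one-form: its value on a coarse bond is placed on the ONE finest bond of each straight fine line that crosses out of the block (the bond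
from the last site of the block in its direction); zero elsewhere. [cite: Balaban1985Variational, (11) p.279] -/
def naive (A : PBond (F.P K) k → ℝ) : PBond (F.P K) 0 → ℝ := fun b =>
  if (b.src b.dir).val % F.L ^ k = F.L ^ k - 1 then A ⟨coarsen k b.src, b.dir⟩ else 0

variable {F K k}

/-- Along the tube of `(y′, μ)`: the `μ`-label of the site at offset `r`, step `t < L^k`, reduced mod `L^k`, is `(r_μ + t) mod L^k`. [folklore] -/
theorem val_tube_self_mod (hk : k ≤ K) (y' : Site (F.P K) k) (r : Fin 3 → Fin (F.L ^ k)) (μ : Fin 3) (t : Fin (F.L ^ k)) :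
    ((shiftN (bsite k y' r) μ t) μ).val % F.L ^ k = ((r μ : ℕ) + t) % F.L ^ k := by
  obtain ⟨h1, h2, h3⟩ := sizes (F := F) hk
  have hdvd : F.L ^ k ∣ N0 F K := ⟨nc F K k, h1⟩
  have ht : (t : ℕ) < N0 F K := t.isLt.trans_le (by rw [h1]; exact Nat.le_mul_of_pos_right _ (by omega))
  rw [shiftN_apply, if_pos rfl, ZMod.val_add, val_bsite3 hk, ZMod.val_natCast, Nat.mod_eq_of_lt ht, Nat.mod_mod_of_dvd _ hdvd,
    show (y' μ).val * F.L ^ k + (r μ : ℕ) + (t : ℕ) = ((r μ : ℕ) + t) + (y' μ).val * F.L ^ k by ring, Nat.add_mul_mod_self_right]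

/-- Along the tube, while `r_μ + t < L^k` the site stays in the block `y′`. [folklore] -/
theorem coarsen_tube_of_lt (hk : k ≤ K) (y' : Site (F.P K) k) (r : Fin 3 → Fin (F.L ^ k)) (μ : Fin 3) (t : Fin (F.L ^ k)) (ht : (r μ : ℕ) + t < F.L ^ k) :
    coarsen k (shiftN (bsite k y' r) μ t) = y' := by
  obtain ⟨h1, h2, h3⟩ := sizes (F := F) hk
  rw [coarsen_eq_iff hk]
  intro i
  by_cases hi : i = μ
  · subst hi
    have hlt : (y' i).val * F.L ^ k + (r i : ℕ) + (t : ℕ) < N0 F K := by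
      have hy : (y' i).val + 1 ≤ nc F K k := ZMod.val_lt (y' i)
      calc (y' i).val * F.L ^ k + (r i : ℕ) + (t : ℕ) < (y' i).val * F.L ^ k + F.L ^ k := by omega
        _ = ((y' i).val + 1) * F.L ^ k := by ring
        _ ≤ nc F K k * F.L ^ k := Nat.mul_le_mul_right _ hy
        _ = N0 F K := by rw [h1, mul_comm]
    rw [shiftN_apply, if_pos rfl, ZMod.val_add, val_bsite3 hk, ZMod.val_natCast, Nat.mod_eq_of_lt ((Nat.le_add_left _ _).trans_lt hlt),
      Nat.mod_eq_of_lt hlt, show (y' i).val * F.L ^ k + (r i : ℕ) + (t : ℕ) = F.L ^ k * (y' i).val + ((r i : ℕ) + t) by ring,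
      Nat.mul_add_div h3, Nat.div_eq_of_lt ht, add_zero]
  · have hi' : ¬ (@Eq (Fin (F.P K).d) i μ) := fun h => hi h
    rw [shiftN_apply, if_neg hi', add_zero, val_bsite3 hk, show (y' i).val * F.L ^ k + (r i : ℕ) = F.L ^ k * (y' i).val + (r i : ℕ) by ring,
      Nat.mul_add_div h3, Nat.div_eq_of_lt (r i).isLt, add_zero]

/-- **★ THE NAIVE LIFT IS EXACT**: `tubeSum (naive A) (y′, μ) = (L^k)³ · A(y′, μ)` — every straight fine line of the tube crosses out of the block `y′` exactly once, at step
`t = L^k − 1 − r_μ`. [cite: Balaban1985Variational, (11)+(13) pp.279–280] -/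
theorem tubeSum_naive (hk : k ≤ K) (A : PBond (F.P K) k → ℝ) (y' : Site (F.P K) k) (μ : Fin 3) :
    tubeSum k (naive F K k A) ⟨y', μ⟩ = ((F.L : ℝ) ^ k) ^ 3 * A ⟨y', μ⟩ := by
  obtain ⟨h1, h2, h3⟩ := sizes (F := F) hk
  have inner : ∀ r : Fin 3 → Fin (F.L ^ k), ∑ t : Fin (F.L ^ k), naive F K k A ⟨shiftN (bsite k y' r) μ t, μ⟩ = A ⟨y', μ⟩ := by
    intro r
    have ht0 : F.L ^ k - 1 - (r μ : ℕ) < F.L ^ k := by omega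
    set t₀ : Fin (F.L ^ k) := ⟨F.L ^ k - 1 - (r μ : ℕ), ht0⟩
    have key : ∀ t : Fin (F.L ^ k), naive F K k A ⟨shiftN (bsite k y' r) μ t, μ⟩ = if t = t₀ then A ⟨y', μ⟩ else 0 := by
      intro t
      unfold naive
      simp only
      rw [val_tube_self_mod hk]
      have hr := (r μ).isLt; have ht := t.isLt
      by_cases h : t = t₀
      · have htv : (t : ℕ) = F.L ^ k - 1 - (r μ : ℕ) := by rw [h]
        have hsum : (r μ : ℕ) + t = F.L ^ k - 1 := by omega
        rw [if_pos (by rw [hsum, Nat.mod_eq_of_lt (by omega)]), if_pos h, coarsen_tube_of_lt hk y' r μ t (by omega)]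
      · have htv : (t : ℕ) ≠ F.L ^ k - 1 - (r μ : ℕ) := fun e => h (Fin.ext e)
        rw [if_neg, if_neg h]
        intro hmod
        -- `(r_μ + t) mod L^k = L^k − 1` with `r_μ + t ≤ 2L^k − 2` forces `r_μ + t = L^k − 1`
        rcases Nat.lt_or_ge ((r μ : ℕ) + t) (F.L ^ k) with hlt | hge
        · rw [Nat.mod_eq_of_lt hlt] at hmod; omega
        · rw [Nat.mod_eq_sub_mod hge, Nat.mod_eq_of_lt (by omega)] at hmod; omega
    rw [Finset.sum_congr rfl fun t _ => key t, Finset.sum_ite_eq']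
    simp
  show ∑ r : Fin 3 → Fin (F.L ^ k), ∑ t : Fin (F.L ^ k), naive F K k A ⟨shiftN (bsite k y' r) μ t, μ⟩ = _
  simp only [inner, Finset.sum_const, Finset.card_univ, Fintype.card_fun, Fintype.card_fin, nsmul_eq_mul]
  push_cast
  ring

/-- Integer division after a unit step: a carry occurs exactly at the last label of a block. [folklore] -/
theorem succ_div {n v : ℕ} (hn : 0 < n) : (v + 1) / n = v / n + (if v % n = n - 1 then 1 else 0) := by
  have hdm := Nat.div_add_mod v n
  have hml := Nat.mod_lt v hn
  by_cases h : v % n = n - 1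
  · rw [if_pos h]
    apply Nat.div_eq_of_lt_le
    · have : (v / n + 1) * n = n * (v / n) + n := by ring
      omega
    · have : (v / n + 1 + 1) * n = n * (v / n) + n + n := by ring
      omega
  · rw [if_neg h, add_zero]
    apply Nat.div_eq_of_lt_le
    · have : v / n * n = n * (v / n) := by ring
      omega
    · have : (v / n + 1) * n = n * (v / n) + n := by ring
      omega

/-- The last label of a period is the last label of its block: `(v+1) ≡ 0 (mod n) → v mod n = n − 1`. [folklore] -/
theorem mod_pred_of_succ_mod_zero {n v : ℕ} (hn : 0 < n) (h : (v + 1) % n = 0) : v % n = n - 1 := by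
  by_cases hn1 : n = 1
  · subst hn1; simp [Nat.mod_one]
  · have hml := Nat.mod_lt v hn
    have h2 : (v % n + 1) % n = 0 := by rwa [Nat.add_mod, Nat.one_mod_eq_one.mpr hn1] at h
    rcases Nat.lt_or_ge (v % n + 1) n with hlt | hge
    · rw [Nat.mod_eq_of_lt hlt] at h2; omega
    · omega

/-- Block labels through `val`, read for the `T3Family` parameters. [folklore] -/
theorem val_coarsen3 (hk : k ≤ K) (z : Site (F.P K) 0) (i : Fin 3) : ((coarsen k z) i).val = (z i).val / F.L ^ k :=
  val_coarsen k (le_standing hk) z i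

/-- **THE BLOCK OF A SHIFTED SITE**: it moves by one coarse step exactly when the site is the last of its block in that direction (standing range; torus wrap-around
included). [cite: Balaban1987RG1, (0.3) p.252] -/
theorem coarsen_shift (hk : k ≤ K) (z : Site (F.P K) 0) (α : Fin 3) :
    coarsen k (z.shift α) = if (z α).val % F.L ^ k = F.L ^ k - 1 then (coarsen k z).shift α else coarsen k z := by
  obtain ⟨h1, h2, h3⟩ := sizes (F := F) hk
  split_ifs with hc
  · rw [coarsen_eq_iff hk]
    intro i
    by_cases hi : i = α
    · subst hi
      rw [Site.shift_apply, if_pos rfl, Site.shift_apply, if_pos rfl, ZMod.val_add, ZMod.val_one, ZMod.val_add, ZMod.val_one, val_coarsen3 hk]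
      rcases Nat.lt_or_ge ((z i).val + 1) (N0 F K) with hlt | hge
      · rw [Nat.mod_eq_of_lt hlt, succ_div h3, if_pos hc]
        have hq : (z i).val / F.L ^ k + 1 < nc F K k := by
          have : ((z i).val + 1) / F.L ^ k < nc F K k := by rw [Nat.div_lt_iff_lt_mul h3, mul_comm, ← h1]; exact hlt
          rwa [succ_div h3, if_pos hc] at this
        rw [Nat.mod_eq_of_lt hq]
      · have heq : (z i).val + 1 = N0 F K := le_antisymm (ZMod.val_lt _) hge
        rw [heq, Nat.mod_self, Nat.zero_div]
        have hq : (z i).val / F.L ^ k + 1 = nc F K k := by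
          have := succ_div (v := (z i).val) h3
          rw [if_pos hc, heq, h1, Nat.mul_div_cancel_left _ h3] at this
          omega
        rw [hq, Nat.mod_self]
    · have hi' : ¬ (@Eq (Fin (F.P K).d) i α) := fun h => hi h
      rw [Site.shift_apply, if_neg hi', Site.shift_apply, if_neg hi', val_coarsen3 hk]
  · rw [coarsen_eq_iff hk]
    intro i
    by_cases hi : i = α
    · subst hi
      rw [Site.shift_apply, if_pos rfl, ZMod.val_add, ZMod.val_one, val_coarsen3 hk]
      have hlt : (z i).val + 1 < N0 F K := by
        rcases Nat.lt_or_ge ((z i).val + 1) (N0 F K) with hlt | hge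
        · exact hlt
        · exfalso
          have heq : (z i).val + 1 = N0 F K := le_antisymm (ZMod.val_lt _) hge
          apply hc
          apply mod_pred_of_succ_mod_zero h3
          rw [heq, h1, Nat.mul_mod_right]
      rw [Nat.mod_eq_of_lt hlt, succ_div h3, if_neg hc, add_zero]
    · have hi' : ¬ (@Eq (Fin (F.P K).d) i α) := fun h => hi h
      rw [Site.shift_apply, if_neg hi', val_coarsen3 hk]

/-- **THE CURL OF THE NAIVE LIFT**: `(curl A)(block)` on the fine plaquettes of the corner lines (both labels at the end of their blocks), zero elsewhere.
[cite: Balaban1987RG1, (0.4) p.253] -/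
theorem curl_naive (hk : k ≤ K) (A : PBond (F.P K) k → ℝ) (z : Site (F.P K) 0) {α β : Fin 3} (hαβ : α ≠ β) :
    curlAt (naive F K k A) z α β =
      if (z α).val % F.L ^ k = F.L ^ k - 1 ∧ (z β).val % F.L ^ k = F.L ^ k - 1 then curlAt A (coarsen k z) α β else 0 := by
  have hβα : ¬ (@Eq (Fin (F.P K).d) β α) := fun h => hαβ h.symm
  have hαβ' : ¬ (@Eq (Fin (F.P K).d) α β) := fun h => hαβ h
  have eβ : ((z.shift α) β).val = (z β).val := by rw [Site.shift_apply, if_neg hβα]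
  have eα : ((z.shift β) α).val = (z α).val := by rw [Site.shift_apply, if_neg hαβ']
  simp only [curlAt, naive, eβ, eα, coarsen_shift hk]
  by_cases ha : (z α).val % F.L ^ k = F.L ^ k - 1 <;> by_cases hb : (z β).val % F.L ^ k = F.L ^ k - 1 <;>
    simp [ha, hb]

end Naive

end Summit.QuantumFields.YangMills.Theorems.AbelianEML.Tensor

end
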